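import Mathlib
import HarnessLib
import Summits.ValiantsHypothesis.ValiantsHypothesis.Theorems.MonotoneRestorationOrbitRestorationQPSmlLowRankNarrow
import Summits.ValiantsHypothesis.ValiantsHypothesis.Theorems.MonotoneRestorationOrbitRestorationQPSmlChainRule
import Summits.ValiantsHypothesis.ValiantsHypothesis.Theorems.MonotoneRestorationOrbitRestorationQPSmlFlattening

/-!
# Small column-set-multilinear `ΣΠΣ` circuits of bisymmetric polynomials have narrow power-sum support
(crux `OrbitRestorationQP`, stmt-ValiantsHypothesis-18293 — lane SML: the column-set-multilinear `ΣΠΣ` stratum of A_∞)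

The matrix-side (`f`-world) form of the lower-bound half of the set-multilinear stratum (blueprint
`SML-STRATUM-BLUEPRINT.md`, F5c = F4 + F5a + F5b):

**THEOREM `narrow_of_colSml_lt_choose`.**  Let `f = Σ_{t<s} Π_{b<n} (Σ_a α_{t,b,a} x_{(a,b)})` be a column-set-multilinear
`ΣΠΣ` expression which is ROW- and COLUMN-symmetric (invariant under `(a,b) ↦ (σ a, b)` and `(a,b) ↦ (a, τ b)`), and let
`2j ≤ n`, `s < C(n-j, j)`.  Then `p = rename Prod.fst f` (the symmetric form `x_{ab} ↦ y_a`) is a `ℂ`-combination of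
power-sum products `Π_{k∈μ} p_k`, `μ ⊢ n`, with FEWER THAN `j` parts `≥ 2`.

Contrapositive (the lower bound): if the power-sum expansion of `p` involves a partition with `≥ j` parts `≥ 2`, every
column-symmetric column-sml `ΣΠΣ` expression for `f` has at least `C(n-j, j)` product gates. [folklore]
-/

set_option linter.dupNamespace false

namespace Summit.ValiantsHypothesis.ValiantsHypothesis.Theorems.SmlColNarrow

open MvPolynomial SmlLowRankNarrow SmlChainRule SmlFlattening

/-- **Small column-sml circuits force narrow power-sum support.** [folklore] -/
theorem narrow_of_colSml_lt_choose {n s j : ℕ} (h2j : 2 * j ≤ n) (α : Fin s → Fin n → Fin n → ℂ)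
    (hrow : ∀ σ : Equiv.Perm (Fin n), rename (fun v : Fin n × Fin n => (σ v.1, v.2))
      (∑ t : Fin s, ∏ b : Fin n, ∑ a : Fin n, C (α t b a) * X (a, b) : MvPolynomial (Fin n × Fin n) ℂ) =
      ∑ t : Fin s, ∏ b : Fin n, ∑ a : Fin n, C (α t b a) * X (a, b))
    (hcol : ∀ τ : Equiv.Perm (Fin n), rename (fun v : Fin n × Fin n => (v.1, τ v.2))
      (∑ t : Fin s, ∏ b : Fin n, ∑ a : Fin n, C (α t b a) * X (a, b) : MvPolynomial (Fin n × Fin n) ℂ) =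
      ∑ t : Fin s, ∏ b : Fin n, ∑ a : Fin n, C (α t b a) * X (a, b))
    (hs : s < Nat.choose (n - j) j) :
    ∃ (S : Finset (Multiset ℕ)) (c : Multiset ℕ → ℂ),
      (∀ μ ∈ S, (∀ k ∈ μ, 0 < k) ∧ μ.sum = n ∧ (μ.filter fun k => 2 ≤ k).card < j) ∧
      rename (Prod.fst : Fin n × Fin n → Fin n)
          (∑ t : Fin s, ∏ b : Fin n, ∑ a : Fin n, C (α t b a) * X (a, b)) =
        ∑ μ ∈ S, c μ • (μ.map (psum (Fin n) ℂ)).prod := by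
  classical
  have hsymm : (rename (Prod.fst : Fin n × Fin n → Fin n)
      (∑ t : Fin s, ∏ b : Fin n, ∑ a : Fin n, C (α t b a) * X (a, b))).IsSymmetric :=
    isSymmetric_rename_fst _ hrow
  have hhom : (rename (Prod.fst : Fin n × Fin n → Fin n)
      (∑ t : Fin s, ∏ b : Fin n, ∑ a : Fin n, C (α t b a) * X (a, b))).IsHomogeneous n := by
    rw [rename_fst_colSml]
    simpa using isHomogeneous_rename_fst_colSml (σ := Fin n) (τ := Fin n) α
  have hjn : j ≤ n := by omega
  refine narrow_of_derivs_in_small_span le_rfl h2j _ hsymm hhom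
    (Finset.univ.image fun t : Fin s => rename (Prod.fst : Fin n × Fin n → Fin n)
      (∏ b ∈ Finset.univ \ Finset.univ.image (fun i : Fin j => (⟨(i : ℕ), by omega⟩ : Fin n)),
        ∑ a : Fin n, C (α t b a) * X (a, b)))
    (fun ρ => derivs_rename_fst_mem_span hjn α hcol ρ) ?_
  calc (Finset.univ.image fun t : Fin s => rename (Prod.fst : Fin n × Fin n → Fin n)
        (∏ b ∈ Finset.univ \ Finset.univ.image (fun i : Fin j => (⟨(i : ℕ), by omega⟩ : Fin n)),
          ∑ a : Fin n, C (α t b a) * X (a, b))).card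
      ≤ (Finset.univ : Finset (Fin s)).card := Finset.card_image_le
    _ = s := by simp
    _ < Nat.choose (n - j) j := hs

end Summit.ValiantsHypothesis.ValiantsHypothesis.Theorems.SmlColNarrow
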